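import Literature.AlgebraicGeometry.Modules.PushforwardIsoUnit
import HarnessLib

/-!
# Naturality of `f_* 𝓗om(E, M) ⟶ 𝓗om(f_* E, f_* M)` in the FIRST (contravariant) variable

Layer `Literature/AlgebraicGeometry/Modules`; sequel to `SheafHomPushforward.lean` (the comparison
`sheafHomPushforwardComparison f E M`, an isomorphism `sheafHomPushforwardIso ε E M` along an isomorphism `ε`) and
`PushforwardIsoUnit.lean` (its naturality in the SECOND variable, `pushforward_map_sheafHomMap_comp_comparison` /
`sheafHomFunctorCompPushforwardIso`). Here: naturality in the FIRST variable, i.e. compatibility with pre-composition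
`sheafHomMapLeft g M : 𝓗om(E₂, M) ⟶ 𝓗om(E₁, M)` for `g : E₁ ⟶ E₂` (`Modules/SheafHomLeft.lean`):

* `pushforward_map_sheafHomMapLeft_comp_comparison` — `f_* 𝓗om(g, M) ≫ cmp_{E₁} = cmp_{E₂} ≫ 𝓗om(f_* g, f_* M)` (any `f`);
* `sheafHomPushforwardIso_hom_naturality_left` — the same for the isomorphism along `ε : Y₀ ≅ Y₁`;
* `sheafHomPushforwardIso_hom_naturality` — both variables at once (`g : E₁ ⟶ E₂`, `h : M ⟶ N`).

Everything is a values computation (`appLE`, `rfl`). Motivation: the internal Hom BICOMPLEX `(q, i) ↦ 𝓗om(E^{-i}, F^q)` of the venture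
HSemireg (`HodgeTheory/HomComplex.lean`) along `ε_*` needs naturality in both variables (banked support target
`HomComplex.IsISemiregularC.of_schemeIso`, piece (N1), cell `pub-hodge-ring2`).

References: R. Hartshorne, *Algebraic Geometry* (1977), II §5 pp. 109–110 (the sheaf Hom; direct images) [Hartshorne1977];
bookkeeping along a morphism of schemes (reading).
-/

noncomputable section

-- `TopCat.Presheaf`/`Scheme.Modules` are not reducible (as in Mathlib's `AlgebraicGeometry/Modules/Sheaf.lean`).
set_option backward.isDefEq.respectTransparency false

open CategoryTheory AlgebraicGeometry Opposite TopologicalSpace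
open AlgebraicGeometry.Scheme.Modules

universe u

namespace Literature.AlgebraicGeometry.Modules

section Comparison

variable {Y₀ Y₁ : Scheme.{u}} (f : Y₀ ⟶ Y₁) {E₁ E₂ : Y₀.Modules} (g : E₁ ⟶ E₂) (M : Y₀.Modules)

/-- **Naturality of the comparison `f_* 𝓗om(E, M) ⟶ 𝓗om(f_* E, f_* M)` in `E`** (any morphism `f`): for `g : E₁ ⟶ E₂`,
`f_*(𝓗om(g, M)) ≫ cmp_{E₁} = cmp_{E₂} ≫ 𝓗om(f_* g, f_* M)`. [cite: Hartshorne1977, II §5 pp. 109–110 (the sheaf Hom and direct images f_*; reading: bookkeeping along a morphism of schemes)] -/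
theorem pushforward_map_sheafHomMapLeft_comp_comparison :
    (pushforward f).map (sheafHomMapLeft g M) ≫ sheafHomPushforwardComparison f E₁ M =
      sheafHomPushforwardComparison f E₂ M ≫
        sheafHomMapLeft ((pushforward f).map g) ((pushforward f).obj M) := by
  refine Scheme.Modules.hom_ext _ _ fun U => AddCommGrpCat.ext
    fun (φ₀ : E₂.over (f ⁻¹ᵁ U) ⟶ M.over (f ⁻¹ᵁ U)) => ?_
  change pushforwardOverHom f E₁ M ((sheafHomMapLeft g M).app (f ⁻¹ᵁ U) φ₀) =
    (sheafHomMapLeft ((pushforward f).map g) ((pushforward f).obj M)).app U (pushforwardOverHom f E₂ M φ₀)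
  rw [sheafHomMapLeft_app_apply, sheafHomMapLeft_app_apply]
  exact hom_ext_of_appLE fun _ _ _ => rfl

end Comparison

section Iso

variable {Y₀ Y₁ : Scheme.{u}} (ε : Y₀ ≅ Y₁) {E₁ E₂ : Y₀.Modules} (g : E₁ ⟶ E₂) {M N : Y₀.Modules}

/-- **Naturality of `ε_* 𝓗om(E, M) ≅ 𝓗om(ε_* E, ε_* M)` in `E`** for an isomorphism of schemes `ε`.
[cite: Hartshorne1977, II §5 pp. 109–110 (the sheaf Hom and direct images f_*; reading: bookkeeping along an isomorphism of schemes)] -/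
theorem sheafHomPushforwardIso_hom_naturality_left (M : Y₀.Modules) :
    (pushforward ε.hom).map (sheafHomMapLeft g M) ≫ (sheafHomPushforwardIso ε E₁ M).hom =
      (sheafHomPushforwardIso ε E₂ M).hom ≫ sheafHomMapLeft ((pushforward ε.hom).map g) ((pushforward ε.hom).obj M) := by
  rw [sheafHomPushforwardIso_hom, sheafHomPushforwardIso_hom]
  exact pushforward_map_sheafHomMapLeft_comp_comparison ε.hom g M

/-- **Bi-naturality of `ε_* 𝓗om(E, M) ≅ 𝓗om(ε_* E, ε_* M)`**: for `g : E₁ ⟶ E₂` and `h : M ⟶ N`,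
`ε_*(𝓗om(g, M) ≫ 𝓗om(E₁, h)) ≫ iso = iso ≫ 𝓗om(ε_* g, ε_* M) ≫ 𝓗om(ε_* E₁, ε_* h)`.
[cite: Hartshorne1977, II §5 pp. 109–110 (the sheaf Hom and direct images f_*; reading: bookkeeping along an isomorphism of schemes)] -/
theorem sheafHomPushforwardIso_hom_naturality (h : M ⟶ N) :
    (pushforward ε.hom).map (sheafHomMapLeft g M ≫ sheafHomMap E₁ h) ≫ (sheafHomPushforwardIso ε E₁ N).hom =
      (sheafHomPushforwardIso ε E₂ M).hom ≫ sheafHomMapLeft ((pushforward ε.hom).map g) ((pushforward ε.hom).obj M) ≫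
        sheafHomMap ((pushforward ε.hom).obj E₁) ((pushforward ε.hom).map h) := by
  rw [Functor.map_comp, Category.assoc, sheafHomPushforwardIso_hom, sheafHomPushforwardIso_hom,
    pushforward_map_sheafHomMap_comp_comparison, ← Category.assoc, pushforward_map_sheafHomMapLeft_comp_comparison,
    Category.assoc]

end Iso

end Literature.AlgebraicGeometry.Modules

end
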